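import Literature.NumberTheory.K2Lit.SiegelDoubledUnipotent
import Literature.NumberTheory.Automorphic.DoubledUnitaryRankOneReductionDiag
import HarnessLib

/-!
# The Weyl element `w_Δ` of the doubled Siegel parabolic is rational (O41.3, file (iii-d))

Track B ∕ hLiu418 = stmt-HodgeConjecture-24832, line `K2_Liu_CurveThetaSigs`, unit U6 «FIRST TERM», socket #41, organ O41.3 (seat
`hodgecm-mathlib-K2Liu-p06` (g0), LEAD F0P6-plan deal 2026-09-03T23:05:23Z).  ★ D9 `K2Lit/SiegelDoubledUnipotent` defines
`weylDelta = ι(1, −1) ∈ H(𝔸)` and records «it lies in `H(L⁺)` — bookkeeping owed». This file pays it: the `GL_{2n}(𝔸_L)`-matrix of `w_Δ` is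
the base change of the rational matrix `e₂·diag(1, −1)·e₂⁻¹` (★ `blk_weylDelta`), and an element of `U(𝔻)(𝔸)` with an `L`-rational matrix is a
rational point (★ `DoubledUnitary.RankOneReduction.mem_range_toAdelic_iff`).  Consumers: the injection `ν ↦ [w_Δ ν] : N_Δ(L⁺) → P_Δ(L⁺)\H(L⁺)`
of the intertwining-operator majorant (O41.3), the `[w_Δ]`-orbit of the constant term (O41.4), the Bruhat cells (O41.1).

Theorems only; axioms ⊆ {propext, Classical.choice, Quot.sound}.

## References
* S. Gelbart, I. Piatetski-Shapiro, S. Rallis, *Explicit constructions of automorphic L-functions*, LNM 1254 (1987), Part A §1 (the doubled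
  group, its Siegel parabolic and Weyl element) [GelbartPiatetskishapiroRallis1987].
* C. Moeglin, J.-L. Waldspurger, *Spectral decomposition and Eisenstein series* (1995), II.1.6 (`w ∈ G(k)`) [MoeglinWaldspurger1995].

HONEST LABEL: HC_CM is proved only modulo the 7 printed citations (2 remaining named inputs: hLiu418 = stmt-HodgeConjecture-24832,
h413 = stmt-HodgeConjecture-24833) until rung 0 closes; this helper moves no counter.
-/

noncomputable section

set_option autoImplicit false

set_option linter.dupNamespace false

open scoped Matrix
open NumberField IsDedekindDomain

namespace Summit.HodgeConjecture.HodgeConjecture.Cruxes.HLiu418.K2LiuWeylDeltaRational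

open Literature.NumberTheory.Automorphic Literature.NumberTheory.GaloisRepresentations
open Literature.NumberTheory.Automorphic.DoubledUnitary.RankOneReduction
open Literature.NumberTheory.GelbartRogawski1991 Literature.NumberTheory.GelbartRogawski1991.GRConstruction
open Literature.NumberTheory.K2Lit.SiegelDoubled

variable (L : Type) [Field L] [NumberField L] [IsCMField L]
variable {N M n : ℕ} (e : Fin N × Fin M ≃ Fin n)
  (dV : Fin N → L) (hdV : ∀ i, IsCMField.complexConj L (dV i) = dV i)
  (dW : Fin M → L) (hdW : ∀ i, IsCMField.complexConj L (dW i) = dW i)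

/-- **The matrix of `w_Δ` is rational**: the `GL_{2n}(𝔸_L)`-matrix of `weylDelta` is the base change to `𝔸_L` of the `L`-matrix
`e₂ · diag(1, −1) · e₂⁻¹` (from ★ `blk_weylDelta`). [cite: GelbartPiatetskishapiroRallis1987, Part A §1] -/
theorem coe_weylDelta_eq_map :
    (((weylDelta L e dV hdV dW hdW : HA L e dV hdV dW hdW) : GL (Fin (n + n)) (AdeleRing (𝓞 L) L)) :
        Matrix (Fin (n + n)) (Fin (n + n)) (AdeleRing (𝓞 L) L)) =
      (Matrix.reindex (e₂ (n := n)) (e₂ (n := n))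
        (Matrix.fromBlocks (1 : Matrix (Fin n) (Fin n) L) 0 0 (-1))).map (algebraMap L (AdeleRing (𝓞 L) L)) := by
  have h := blk_weylDelta L e dV hdV dW hdW
  have h2 : (((weylDelta L e dV hdV dW hdW : HA L e dV hdV dW hdW) : GL (Fin (n + n)) (AdeleRing (𝓞 L) L)) :
        Matrix (Fin (n + n)) (Fin (n + n)) (AdeleRing (𝓞 L) L)) =
      Matrix.reindex (e₂ (n := n)) (e₂ (n := n)) (blk L e dV hdV dW hdW (weylDelta L e dV hdV dW hdW)) := by
    simp only [blk, Matrix.reindex_apply, Equiv.symm_symm, Matrix.submatrix_submatrix, Equiv.self_comp_symm,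
      Matrix.submatrix_id_id]
  rw [h2, h, Matrix.reindex_apply, Matrix.reindex_apply, ← Matrix.submatrix_map, Matrix.fromBlocks_map,
    Matrix.map_one (algebraMap L (AdeleRing (𝓞 L) L)) (map_zero _) (map_one _),
    Matrix.map_zero (algebraMap L (AdeleRing (𝓞 L) L)) (map_zero _),
    Matrix.map_neg (algebraMap L (AdeleRing (𝓞 L) L)) (map_neg _),
    Matrix.map_one (algebraMap L (AdeleRing (𝓞 L) L)) (map_zero _) (map_one _)]

omit [NumberField L] [IsCMField L] in
/-- the rational matrix `e₂ · diag(1, −1) · e₂⁻¹` is an involution. [cite: GelbartPiatetskishapiroRallis1987, Part A §1] -/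
theorem weylMatrix_mul_self :
    Matrix.reindex (e₂ (n := n)) (e₂ (n := n)) (Matrix.fromBlocks (1 : Matrix (Fin n) (Fin n) L) 0 0 (-1)) *
        Matrix.reindex (e₂ (n := n)) (e₂ (n := n)) (Matrix.fromBlocks (1 : Matrix (Fin n) (Fin n) L) 0 0 (-1)) = 1 := by
  rw [Matrix.reindex_apply, Matrix.submatrix_mul_equiv, Matrix.fromBlocks_multiply]
  simp only [mul_one, mul_zero, add_zero, zero_add, mul_neg, neg_neg, neg_zero, Matrix.fromBlocks_one,
    Matrix.submatrix_one_equiv]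

/-- **`w_Δ ∈ H(L⁺)`**: the Weyl element of the doubled Siegel parabolic is a rational point of `H` (its matrix is `L`-rational, ★
`mem_range_toAdelic_iff`).  [cite: GelbartPiatetskishapiroRallis1987, Part A §1] [cite: MoeglinWaldspurger1995, II.1.6] -/
theorem weylDelta_mem_ratH : weylDelta L e dV hdV dW hdW ∈ ratH L e dV hdV dW hdW := by
  set W₀ : Matrix (Fin (n + n)) (Fin (n + n)) L :=
    Matrix.reindex (e₂ (n := n)) (e₂ (n := n)) (Matrix.fromBlocks (1 : Matrix (Fin n) (Fin n) L) 0 0 (-1)) with hW₀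
  have hW : W₀ * W₀ = 1 := weylMatrix_mul_self L
  let g : GL (Fin (n + n)) L := ⟨W₀, W₀, hW, hW⟩
  refine (mem_range_toAdelic_iff (Fp L) L (IsCMField.complexConj L) (hermD L e dV hdV dW hdW)
    (weylDelta L e dV hdV dW hdW)).2 ⟨g, ?_⟩
  refine Units.ext ?_
  rw [coe_weylDelta_eq_map]
  rfl

end Summit.HodgeConjecture.HodgeConjecture.Cruxes.HLiu418.K2LiuWeylDeltaRational

end
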